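import Summits.QuantumFields.BalabanUV.Beta.GAN24.SubAveragingFibre
import Literature.MathematicalPhysics.QuantumFieldTheory.Balaban1983to89.B4Green244

/-!
# `BalabanUV.Beta.GAN24.SubAveragingFibreColumn` — binder row G-an2-4 ∕ (CONV-C), programme «SUBAVG-RATE»
# (ROUTES-GAN24 R2-S1∕S2 ∘ R3-S3 executed at `U = 1` in the fibre∕strip currency), FILE 3b:
# THE TWO REGROUPED DENOMINATORS `E(n·L)`, `E(n)` OF B4 (2.48) THROUGH THE COARSE ALIASES, `‖E(n·L) − E(n)‖ = O(n⁻²)`,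
# AND THE COLUMN DIFFERENCE `S_k∕E(n·L) − R_k∕E(n) = O(n⁻²)` ON THE FAT REGION

NOT IN PRINT; OUR PROOF ATTEMPT (prover part P3 of row G-an2-4, fibre∕strip lineage, gen 22; CRUX TEAM (2), ruling «YM REDIRECT
TOWARDS THE SUMMIT», 2026-08-21).  HONEST DEPENDENCY (cell records, verbatim): «continuum YM on T⁴ ⇐ BetaPertH ∧ nine spine
estimates (0/9 proved); BetaPertH ⇐ (D1) ∧ (D4) ∧ CAP+tail; G-an2-4 gates asym, D1 and NE2/3/4.»  HONEST FRAMING (cell contract,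
verbatim): «discharging `BetaPertH` makes Bałaban's UV stability UNCONDITIONAL — a real constructive-QFT result; it is NOT the
continuum limit and NOT the Clay problem.»  ABSOLUTE RULE: nothing printed is a hypothesis; [folklore] algebra and estimates over
`Literature.….B4Strip` (`U`, `uFactor`, `E`, `DeltaXi`), `B4StripCauchy` (`Fat`, `Sxi_ne_zero`, `Sxi_shift_ne_zero`, `sum_norm_U_le`),
`B4StripSums` (`R`, `CR`), `B5Strip145Analytic` (`Sxi_add_nat_mul`) — vendored there with their citation tags — and the siblings
`SubAveragingDirichlet` ∕ `Core` ∕ `CoreEstimate` ∕ `Fibre`.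

## What is proved (every `d`, `n, L ≥ 1`, `a, m² ≥ 0`, `p ∈ Fat d r`, `r ≤ 1∕4`, `d r² ≤ 1∕16`)
* §1 `Kof_injective`, `Kof_bijective`, **`sum_Kof_eq`** (`Σ_{K ∈ (Fin (nL))^d} f K = Σ_k Σ_m f (Kof k m)`); `uFactor_mul_eq` and
  **`U_mul_Kof : U (n·L) (Kof k m) p = U n k p · W1(Kof k m) p`** (composition of block averagings, B5 (1.17), alias by alias, squared
  — filled branches included); the tree's `B4Green244.E_eq_sum_R` (`E n a m2 = (Δ^ξ+m²) + a·Σ_k U_k R_k`, imported BY NAME), **`E_mul_eq_sum`** (`E (n·L) a m2 = (Δ^{ξ∕L}+m²) +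
  a·Σ_k U_k S_k`: the finer bracket of B4 (2.48) IS the coarse-alias sum of `U_k S_k`) and **`norm_E_sub_E_le`** (`‖E(n·L) − E(n)‖ ≤ CE∕n²`).
* §2 `colDiff := S_k∕E(n·L) − R_k∕E(n)` and **`norm_colDiff_le`** (`≤ Ccol(d,L,a,m²,c)∕n²` for EVERY `k`, given a common lower bound
  `0 < c ≤ ‖E‖` at both levels — supplied uniformly in `n` on a strip by the tree's `B4StripCauchy.uniformStrip_holds`).

NOT HERE: the multiplier identity and the kernels (FILE 4 `SubAveragingKernel`).  0∕4 row-D1 binders touched; NEVER «G-an2-4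
closed»; NOT D1, NOT BetaPertH, NOT continuum, NOT Clay.  Provenance: prover-b2b-balaban-gan24-p3-g22-0 (unit `b2b-balaban-gan24-p3`,
gen 22), 2026-08-21.
-/

noncomputable section

namespace Summit.QuantumFields.BalabanUV.Beta.GAN24.SubAveragingFibreColumn

open Complex Finset
open Literature.MathematicalPhysics.QuantumFieldTheory.Balaban1983to89
open Literature.MathematicalPhysics.QuantumFieldTheory.Balaban1983to89.B4Strip
open Literature.MathematicalPhysics.QuantumFieldTheory.Balaban1983to89.B4StripCauchy
open Literature.MathematicalPhysics.QuantumFieldTheory.Balaban1983to89.B4StripSums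
open Literature.MathematicalPhysics.QuantumFieldTheory.Balaban1983to89.B5Strip145Analytic (Sxi_add_nat_mul)
open Summit.QuantumFields.BalabanUV.Beta.GAN24.SubAveragingDirichlet
open Summit.QuantumFields.BalabanUV.Beta.GAN24.SubAveragingCore
open Summit.QuantumFields.BalabanUV.Beta.GAN24.SubAveragingCoreEstimate
open Summit.QuantumFields.BalabanUV.Beta.GAN24.SubAveragingFibre
open scoped Real

variable {d : ℕ}

/-! ## §1 The alias re-indexing `K ↔ (k, m)`, the factorisation of `U`, and the two regrouped denominators -/

/-- [folklore] `(k, m) ↦ Kof k m` is injective. -/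
theorem Kof_injective (n L : ℕ) [NeZero n] :
    Function.Injective (fun km : (Fin d → Fin n) × (Fin d → Fin L) => Kof n L km.1 km.2) := by
  rintro ⟨k, m⟩ ⟨k', m'⟩ h
  have hν : ∀ ν, (k ν : ℕ) + n * (m ν : ℕ) = (k' ν : ℕ) + n * (m' ν : ℕ) := fun ν => by
    have := congrArg (fun K => ((K ν : Fin (n * L)) : ℕ)) h
    simpa [Kof_val] using this
  have hk : k = k' := by
    funext ν
    apply Fin.ext
    have h1 := congrArg (· % n) (hν ν)
    simp only [Nat.add_mul_mod_self_left, Nat.mod_eq_of_lt (k ν).isLt, Nat.mod_eq_of_lt (k' ν).isLt] at h1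
    exact h1
  subst hk
  have hm : m = m' := by
    funext ν
    apply Fin.ext
    have h1 := hν ν
    have hn := Nat.pos_of_ne_zero (NeZero.ne n)
    have : n * (m ν : ℕ) = n * (m' ν : ℕ) := by omega
    exact Nat.eq_of_mul_eq_mul_left hn this
  rw [hm]

/-- [folklore] `(k, m) ↦ Kof k m` is a bijection onto the finer aliases (injective between finite types of equal cardinality
`n^d·L^d = (nL)^d`). -/
theorem Kof_bijective (n L : ℕ) [NeZero n] :
    Function.Bijective (fun km : (Fin d → Fin n) × (Fin d → Fin L) => Kof n L km.1 km.2) := by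
  rw [Fintype.bijective_iff_injective_and_card]
  refine ⟨Kof_injective n L, ?_⟩
  simp only [Fintype.card_prod, Fintype.card_pi, Finset.prod_const, Fintype.card_fin, Finset.card_univ]
  rw [← mul_pow]

/-- [folklore] **RE-INDEXING OF THE FINER ALIAS SUM**: `Σ_{K ∈ (Fin (nL))^d} f(K) = Σ_k Σ_m f(Kof k m)`. -/
theorem sum_Kof_eq (n L : ℕ) [NeZero n] (f : (Fin d → Fin (n * L)) → ℂ) :
    ∑ K : Fin d → Fin (n * L), f K = ∑ k : Fin d → Fin n, ∑ m : Fin d → Fin L, f (Kof n L k m) := by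
  rw [← Fintype.sum_prod_type']
  exact (Function.Bijective.sum_comp (Kof_bijective n L) f).symm

/-- [folklore] ONE COORDINATE OF THE FACTORISATION: `uFactor (n·L) (j + n·m) z = uFactor n j z · sw n L (j + n·m) z` on the fat box
`|Re z| ≤ π + r` (`r ≤ 1∕4`), for `j < n`, `m < L` — the continued `|u_{nL}|²` is the continued `|u_n|²` times the sub-weight
(filled branches included). -/
theorem uFactor_mul_eq (n L : ℕ) (hn : 1 ≤ n) (hL : 1 ≤ L) {j m : ℕ} (hj : j < n) (hmL : m < L) {r : ℝ} (hr : r ≤ 1 / 4)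
    {z : ℂ} (hre : |z.re| ≤ π + r) : uFactor (n * L) (j + n * m) z = uFactor n j z * sw n L (j + n * m) z := by
  have hπ := Real.pi_gt_three
  have hre2 : |z.re| < 2 * π := by linarith
  by_cases hK : j + n * m = 0
  · -- then `j = 0` and `m = 0`
    have hj0 : j = 0 := by omega
    have hm0 : n * m = 0 := by omega
    rw [hK, hj0]
    by_cases hz : z = 0
    · subst hz
      have hL' : (L : ℂ) ≠ 0 := Nat.cast_ne_zero.mpr (by omega)
      rw [uFactor_zero_eq, uFactor_zero_eq, if_pos rfl, if_pos rfl, one_mul]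
      unfold sw ang
      rw [Nat.cast_zero, mul_zero, add_zero, zero_div, dir_apply_zero]
      field_simp
    · have h1 : Sxi (n * L) (z + 2 * π * ((0 : ℕ) : ℂ)) ≠ 0 := by
        rw [Nat.cast_zero, mul_zero, add_zero]
        exact Sxi_ne_zero (n * L) (Nat.one_le_iff_ne_zero.mpr (Nat.mul_ne_zero (by omega) (by omega))) hre2 hz
      have h2 : Sxi n z ≠ 0 := Sxi_ne_zero n hn hre2 hz
      rw [sw_eq_div n L hn hL 0 z h1, uFactor_zero_eq, uFactor_zero_eq, if_neg hz, if_neg hz]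
      rw [Nat.cast_zero, mul_zero, add_zero] at h1 ⊢
      field_simp
  · have hK1 : 1 ≤ j + n * m := Nat.one_le_iff_ne_zero.mpr hK
    have hK2 : j + n * m + 1 ≤ n * L := by
      calc j + n * m + 1 ≤ n + n * m := by omega
        _ = n * (m + 1) := by ring
        _ ≤ n * L := Nat.mul_le_mul_left _ hmL
    have h1 : Sxi (n * L) (z + 2 * π * ((j + n * m : ℕ) : ℂ)) ≠ 0 := Sxi_shift_ne_zero (n * L) (j + n * m) hK1 hK2 hr hre
    rw [sw_eq_div n L hn hL _ z h1, uFactor_ne_eq (n * L) _ hK, Sxi_add_nat_mul n (by omega) z j m]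
    by_cases hj0 : j = 0
    · subst hj0
      rw [Nat.cast_zero, mul_zero, add_zero, uFactor_zero_eq]
      by_cases hz : z = 0
      · subst hz
        rw [if_pos rfl]
        have : S1 0 = 0 := by simp [S1]
        have : Sxi n 0 = 0 := by simp [Sxi]
        simp [*]
      · rw [if_neg hz]
        have h2 : Sxi n z ≠ 0 := Sxi_ne_zero n hn hre2 hz
        field_simp
    · rw [uFactor_ne_eq n j hj0]
      have h2 : Sxi n (z + 2 * π * (j : ℂ)) ≠ 0 := Sxi_shift_ne_zero n j (Nat.one_le_iff_ne_zero.mpr hj0) (by omega) hr hre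
      field_simp

/-- [folklore] **`U (n·L) (Kof k m) p = U n k p · W1(Kof k m) p`** on the fat region: the continued `|u_{nL}(p+2πK)|²` is the continued
`|u_n(p+2πk)|²` times the sub-block weight — composition of averagings (B5 (1.17)) alias by alias, squared. -/
theorem U_mul_Kof (n L : ℕ) [NeZero n] [NeZero L] {r : ℝ} (hr : r ≤ 1 / 4) {p : Fin d → ℂ} (hp : p ∈ Fat d r)
    (k : Fin d → Fin n) (m : Fin d → Fin L) : U (n * L) (Kof n L k m) p = U n k p * W1 n L (Kof n L k m) p := by
  have hn : 1 ≤ n := Nat.pos_of_ne_zero (NeZero.ne n)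
  have hL : 1 ≤ L := Nat.pos_of_ne_zero (NeZero.ne L)
  unfold U W1
  rw [← Finset.prod_mul_distrib]
  refine Finset.prod_congr rfl fun ν _ => ?_
  rw [Kof_val]
  exact uFactor_mul_eq n L hn hL (k ν).isLt (m ν).isLt hr (hp ν).1

/-- [folklore] **THE FINER DENOMINATOR THROUGH THE COARSE ALIASES**: `E (n·L) a m2 p = (Δ^{ξ∕L}+m²)(p) + a·Σ_k U n k p · S_k(p)` on
the fat region — the bracket `1 + aΣ|u|²∕(Δ+m²)` of B4 (2.48) one level down IS the coarse-alias sum of `U_k·S_k` (functoriality of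
the block averaging). -/
theorem E_mul_eq_sum (n L : ℕ) [NeZero n] [NeZero L] (a m2 : ℝ) {r : ℝ} (hr : r ≤ 1 / 4) {p : Fin d → ℂ} (hp : p ∈ Fat d r) :
    E (n * L) a m2 p = DeltaXi (n * L) m2 p + a * ∑ k : Fin d → Fin n, U n k p * S n L m2 k p := by
  rw [B4Green244.E_eq_sum_R, sum_Kof_eq]
  congr 2
  refine Finset.sum_congr rfl fun k _ => ?_
  unfold S
  rw [Finset.mul_sum]
  refine Finset.sum_congr rfl fun m _ => ?_
  rw [U_mul_Kof n L hr hp k m, mul_assoc]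

/-- [folklore] the constant of `‖E(n·L) − E(n)‖` (`a ≥ 0`). -/
def CE (d L : ℕ) (a m2 : ℝ) : ℝ := 512 * (d : ℝ) + a * 132 ^ d * CSR d L m2

/-- [folklore] `CE ≥ 0` for `a, m² ≥ 0`. -/
theorem CE_nonneg (d L : ℕ) {a m2 : ℝ} (ha : 0 ≤ a) (hm : 0 ≤ m2) : 0 ≤ CE d L a m2 := by
  have := (CSR_nonneg d L hm).2.2; unfold CE; positivity

/-- [folklore] **`‖E (n·L) a m2 p − E n a m2 p‖ ≤ CE∕n²`** on the fat region (`a ≥ 0`): the two regrouped denominators of B4 (2.48)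
at consecutive levels agree to second order in `ξ`. -/
theorem norm_E_sub_E_le (n L : ℕ) [NeZero n] [NeZero L] (a m2 : ℝ) (ha : 0 ≤ a) (hm : 0 ≤ m2) {r : ℝ} (hr : r ≤ 1 / 4)
    (hdr : (d : ℝ) * r ^ 2 ≤ 1 / 16) {p : Fin d → ℂ} (hp : p ∈ Fat d r) :
    ‖E (n * L) a m2 p - E n a m2 p‖ ≤ CE d L a m2 / (n : ℝ) ^ 2 := by
  have hn0 : (0 : ℝ) < n := by exact_mod_cast Nat.pos_of_ne_zero (NeZero.ne n)
  obtain ⟨-, -, hCSR⟩ := CSR_nonneg d L hm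
  rw [E_mul_eq_sum n L a m2 hr hp, B4Green244.E_eq_sum_R n a m2 p]
  have e : DeltaXi (n * L) m2 p + a * ∑ k : Fin d → Fin n, U n k p * S n L m2 k p
        - (DeltaXi n m2 p + a * ∑ k : Fin d → Fin n, U n k p * R n m2 k p)
      = (DeltaXi (n * L) m2 p - DeltaXi n m2 p) + a * ∑ k : Fin d → Fin n, U n k p * (S n L m2 k p - R n m2 k p) := by
    rw [Finset.mul_sum, Finset.mul_sum, Finset.mul_sum]
    simp only [mul_sub, Finset.sum_sub_distrib]
    ring
  rw [e]
  have h1 := norm_DeltaXi_mul_sub_le n L m2 hr hp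
  have h2 : ‖∑ k : Fin d → Fin n, U n k p * (S n L m2 k p - R n m2 k p)‖ ≤ 132 ^ d * (CSR d L m2 / (n : ℝ) ^ 2) := by
    refine (norm_sum_le _ _).trans ?_
    have h : ∀ k ∈ (Finset.univ : Finset (Fin d → Fin n)),
        ‖U n k p * (S n L m2 k p - R n m2 k p)‖ ≤ ‖U n k p‖ * (CSR d L m2 / (n : ℝ) ^ 2) := by
      intro k _
      rw [norm_mul]
      exact mul_le_mul_of_nonneg_left (norm_S_sub_R_le n L m2 hm hr hdr hp k) (norm_nonneg _)
    refine (Finset.sum_le_sum h).trans ?_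
    rw [← Finset.sum_mul]
    exact mul_le_mul_of_nonneg_right (sum_norm_U_le n hr hp) (by positivity)
  calc ‖DeltaXi (n * L) m2 p - DeltaXi n m2 p + ↑a * ∑ k : Fin d → Fin n, U n k p * (S n L m2 k p - R n m2 k p)‖
      ≤ ‖DeltaXi (n * L) m2 p - DeltaXi n m2 p‖ + ‖(a : ℂ)‖ * ‖∑ k : Fin d → Fin n, U n k p * (S n L m2 k p - R n m2 k p)‖ := by
        refine (norm_add_le _ _).trans ?_; rw [norm_mul]
    _ ≤ 512 * (d : ℝ) / (n : ℝ) ^ 2 + a * (132 ^ d * (CSR d L m2 / (n : ℝ) ^ 2)) := by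
        rw [Complex.norm_real, Real.norm_eq_abs, abs_of_nonneg ha]
        gcongr
    _ = CE d L a m2 / (n : ℝ) ^ 2 := by unfold CE; field_simp

/-! ## §2 The column difference `S_k∕E(n·L) − R_k∕E(n)` -/

/-- [folklore] THE COLUMN DIFFERENCE of the alias `k`: (once-sub-averaged finer regrouped column) − (coarse regrouped column). -/
def colDiff (n L : ℕ) [NeZero n] [NeZero L] (a m2 : ℝ) (k : Fin d → Fin n) (p : Fin d → ℂ) : ℂ :=
  S n L m2 k p / E (n * L) a m2 p - R n m2 k p / E n a m2 p

/-- [folklore] the constant of the column difference, given the common lower bound `c` of `‖E‖` at the two levels. -/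
def Ccol (d L : ℕ) (a m2 c : ℝ) : ℝ := CSR d L m2 / c + CR d m2 * CE d L a m2 / c ^ 2

/-- [folklore] `Ccol ≥ 0`. -/
theorem Ccol_nonneg (d L : ℕ) {a m2 c : ℝ} (ha : 0 ≤ a) (hm : 0 ≤ m2) (hc : 0 < c) : 0 ≤ Ccol d L a m2 c := by
  have h1 := (CSR_nonneg d L hm).2.2
  have h2 := CE_nonneg d L ha hm
  have h3 := CR_nonneg d hm
  unfold Ccol; positivity

/-- [folklore] **THE COLUMN DIFFERENCE IS `O(n⁻²)`, UNIFORMLY IN THE ALIAS AND ON THE FAT REGION**: if `c ≤ ‖E n a m2 p‖` and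
`c ≤ ‖E (n·L) a m2 p‖` (`c > 0`; supplied uniformly in `n`, `a ∈ [a₋,a₊]`, `m² ∈ [0,m²₊]` on a strip by the tree's
`B4StripCauchy.uniformStrip_holds`), then `‖S_k∕E(nL) − R_k∕E(n)‖ ≤ Ccol(d,L,a,m²,c)∕n²` for EVERY `k`. -/
theorem norm_colDiff_le (n L : ℕ) [NeZero n] [NeZero L] (a m2 : ℝ) (ha : 0 ≤ a) (hm : 0 ≤ m2) {r : ℝ} (hr : r ≤ 1 / 4)
    (hdr : (d : ℝ) * r ^ 2 ≤ 1 / 16) {p : Fin d → ℂ} (hp : p ∈ Fat d r) {c : ℝ} (hc : 0 < c) (hcE : c ≤ ‖E n a m2 p‖)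
    (hcE' : c ≤ ‖E (n * L) a m2 p‖) (k : Fin d → Fin n) :
    ‖colDiff n L a m2 k p‖ ≤ Ccol d L a m2 c / (n : ℝ) ^ 2 := by
  have hn0 : (0 : ℝ) < n := by exact_mod_cast Nat.pos_of_ne_zero (NeZero.ne n)
  have hE0 : E n a m2 p ≠ 0 := norm_pos_iff.mp (hc.trans_le hcE)
  have hE'0 : E (n * L) a m2 p ≠ 0 := norm_pos_iff.mp (hc.trans_le hcE')
  have e : colDiff n L a m2 k p = (S n L m2 k p - R n m2 k p) / E (n * L) a m2 p
      + R n m2 k p * (E n a m2 p - E (n * L) a m2 p) / (E n a m2 p * E (n * L) a m2 p) := by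
    unfold colDiff; field_simp; ring
  rw [e]
  have h1 := norm_S_sub_R_le n L m2 hm hr hdr hp k
  have h2 := norm_R_le_CR n m2 hm hr hdr hp k
  have h3 := norm_E_sub_E_le n L a m2 ha hm hr hdr hp
  rw [norm_sub_rev] at h3
  have hCR := CR_nonneg d hm
  obtain ⟨-, -, hCSR⟩ := CSR_nonneg d L hm
  have hCE := CE_nonneg d L ha hm
  have t1 : ‖S n L m2 k p - R n m2 k p‖ / ‖E (n * L) a m2 p‖ ≤ (CSR d L m2 / (n : ℝ) ^ 2) / c :=
    calc ‖S n L m2 k p - R n m2 k p‖ / ‖E (n * L) a m2 p‖ ≤ ‖S n L m2 k p - R n m2 k p‖ / c :=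
          div_le_div_of_nonneg_left (norm_nonneg _) hc hcE'
      _ ≤ (CSR d L m2 / (n : ℝ) ^ 2) / c := div_le_div_of_nonneg_right h1 hc.le
  have t2 : ‖R n m2 k p‖ * ‖E n a m2 p - E (n * L) a m2 p‖ / (‖E n a m2 p‖ * ‖E (n * L) a m2 p‖)
      ≤ CR d m2 * (CE d L a m2 / (n : ℝ) ^ 2) / (c * c) :=
    calc ‖R n m2 k p‖ * ‖E n a m2 p - E (n * L) a m2 p‖ / (‖E n a m2 p‖ * ‖E (n * L) a m2 p‖)
        ≤ ‖R n m2 k p‖ * ‖E n a m2 p - E (n * L) a m2 p‖ / (c * c) :=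
          div_le_div_of_nonneg_left (by positivity) (by positivity) (mul_le_mul hcE hcE' hc.le (norm_nonneg _))
      _ ≤ CR d m2 * (CE d L a m2 / (n : ℝ) ^ 2) / (c * c) :=
          div_le_div_of_nonneg_right (mul_le_mul h2 h3 (norm_nonneg _) hCR) (by positivity)
  calc ‖(S n L m2 k p - R n m2 k p) / E (n * L) a m2 p
        + R n m2 k p * (E n a m2 p - E (n * L) a m2 p) / (E n a m2 p * E (n * L) a m2 p)‖
      ≤ ‖S n L m2 k p - R n m2 k p‖ / ‖E (n * L) a m2 p‖
        + ‖R n m2 k p‖ * ‖E n a m2 p - E (n * L) a m2 p‖ / (‖E n a m2 p‖ * ‖E (n * L) a m2 p‖) := by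
        refine (norm_add_le _ _).trans ?_; rw [norm_div, norm_div, norm_mul, norm_mul]
    _ ≤ (CSR d L m2 / (n : ℝ) ^ 2) / c + CR d m2 * (CE d L a m2 / (n : ℝ) ^ 2) / (c * c) := add_le_add t1 t2
    _ = Ccol d L a m2 c / (n : ℝ) ^ 2 := by unfold Ccol; field_simp

end Summit.QuantumFields.BalabanUV.Beta.GAN24.SubAveragingFibreColumn
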